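import Mathlib.Algebra.BigOperators.Fin
import Mathlib.Data.Matrix.Mul
import Mathlib.Order.ConditionallyCompleteLattice.Basic
import Literature.Computability.Cryptography.TCount
import Literature.Computability.QuantumComplexity.StabilizerRank
import HarnessLib

/-!
# Stabilizer vectors and stabilizer rank over a commutative ring (the integral Clifford dictionary)

Topic `Literature/Computability/QuantumComplexity`; definition request `defn-stabilizerRankOver`
(route `QuantumAdvantage/ModularRank`, items `ModularRankTransfer`, `ModularRankSuperpoly`,
`ModularRankPoly`, which inline these notions).

All matrices of Clifford+`T` circuits have entries in `ℤ[1/√2, i] = 𝔻[ω]`, `ω = e^{iπ/4}`, and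
after multiplication by `√2^k` (`k` = number of Hadamard gates, a *denominator exponent*) in the
ring of cyclotomic integers `ℤ[ω]` (Giles–Selinger 2013, §3 Def. 1 and §3.2 Def. 3). The scaled
gates `√2·H = [[1, 1], [1, −1]]`, `S = diag(1, ω²)`, `T = diag(1, ω)`, `CNOT` therefore make sense
over ANY commutative ring `F` with a chosen element `r` playing the role of `ω` — the intended
instances being `F = ℂ, r = ω` and the residue fields `F = ZMod p`, `p ≡ 1 (mod 8)`, `r⁴ = −1`
(reduction of `ℤ[ω]` modulo a prime above `p`). This file sets up that dictionary and the
resulting field-generic stabilizer rank: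

* `hadamardScaled F`, `phaseOver a`, `cnotOver F` — the gate matrices over `F`;
* `modGateMat r q` — the matrix over `F` of a placed Clifford+`T` gate `q : QGate cliffordT n`
  (`H ↦ √2·H`, `S ↦ diag(1, r²)`, `T ↦ diag(1, r)`, `CNOT ↦ CNOT`, oracle queries `↦ 1`), and
  `modGateEval r C` — the matrix of a circuit, first gate rightmost (the convention of
  `QCircuit.toMatrix`);
* `stabilizerVectorsOver r n` — the (unnormalised) stabilizer vectors over `F`: `M e₀` for `M`
  the matrix of a `T`-free oracle-free Clifford+`T` circuit and `e₀ = Pi.single 0ⁿ 1`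
  (over `ℂ`: `√2^{#H}` times the stabilizer states `C|0ⁿ⟩` of `StabilizerRank.lean`,
  Aaronson–Gottesman 2004, Thm. 1);
* `magicVectorOver r n = (x ↦ r^{|x|})` — over `ℂ` this is `√2ⁿ · |T⟩^{⊗n}`;
* `RepresentableOver r k v` — `v` is an `F`-linear combination of `k` stabilizer vectors — and
  `stabilizerRankOver r v = χ_F(v)`, the least such `k` (Peleg–Shpilka–Volk 2022, §2.1: the
  stabilizer rank of a *function* `𝔽₂ⁿ → ℂ` w.r.t. unnormalised stabilizer functions —
  "normalization has no effect on the stabilizer rank" — read verbatim with coefficients in `F`).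

API: unfolding (`modGateEval_nil/cons/append`), `e₀` and closure of `stabilizerVectorsOver`
under `T`-free words, monotonicity of representability in `k` (`RepresentableOver.mono`) and the
resulting `stabilizerRankOver_le_iff`, the LIST form of representability used verbatim by the
route items (`representableOver_iff_exists_list`), the REDUCTION LEMMA along ring homomorphisms
`θ : F →+* K` (`modGateEval_map`, `magicVectorOver_map`, `RepresentableOver.map`,
`stabilizerRankOver_map_le` — rank can only drop under reduction), and the bridge
`modGateEval_eq_inline` to the inline evaluation term of `Theses/ModularRank.lean` (which sends
`T ↦ 1`; the two agree on `T`-free circuits).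

## References

* B. Giles, P. Selinger, *Exact synthesis of multiqubit Clifford+T circuits*, Phys. Rev. A 87
  (2013) 032332, arXiv:1212.0506: §3 Def. 1 (`ℤ[ω]`, `𝔻[ω] = ℤ[1/√2, i]`), §3.2 Def. 3
  (denominator exponents `√2^k t ∈ ℤ[ω]`).
* S. Peleg, A. Shpilka, B. L. Volk, *Lower bounds on stabilizer rank*, Quantum 6 (2022) 652,
  §2.1 (stabilizer functions `i^{ℓ(x)} (−1)^{q(x)} 1_A`, stabilizer rank of a function).
* S. Bravyi, D. Gosset, *Improved classical simulation of quantum circuits dominated by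
  Clifford gates*, PRL 116 (2016) 250501, §I (stabilizer states `V|0^t⟩`, `χ_t(δ)`).
* S. Aaronson, D. Gottesman, *Improved simulation of stabilizer circuits*, PRA 70 (2004)
  052328, §I and Thm. 1 (Clifford generators `H, S, CNOT`; stabilizer states).

## Design choices

* `T ↦ diag(1, r)` (not `1`): then `modGateEval` is a ring-generic semantics of ALL oracle-free
  Clifford+`T` circuits (over `ℂ`, `r = ω`, it is `√2^{#H} • C.toMatrix`); stabilizer vectors
  only use `T`-free circuits, where the choice is immaterial (`modGateEval_eq_inline`).
* `RepresentableOver` is stated with `Fin k`-indexed families, parallel to `stabilizerRank`;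
  the list form of the route items is `representableOver_iff_exists_list`.
* `stabilizerRankOver` is an `ℕ`-valued `sInf`; `sInf ∅ = 0` is the junk value (over a field of
  characteristic `≠ 2` with `r⁴ = −1` every vector is representable — `X = H S S H` up to the
  unit `2` — which is proved in a sibling file, not here). No hypothesis on `r` is built in.
* Mathlib has no stabilizer formalism (searched `stabilizer rank`, `Clifford`, `qubit`); the
  tree's `ℂ`-side notions are `stabilizerStates`, `stabilizerRank` (`StabilizerRank.lean`).
-/

noncomputable section

namespace Literature.Computability.QuantumComplexity

open Matrix Cryptography

variable {F K : Type*} [CommRing F] [CommRing K] {n : ℕ}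

/-! ### The gate matrices over a commutative ring -/

/-- The **scaled Hadamard matrix** `√2·H = [[1, 1], [1, −1]]` over `F` (entry `−1` at `(1,1)`,
`1` elsewhere). [Giles–Selinger 2013, §3.2 (denominator exponents: `√2·H` has entries in
`ℤ[ω]`)] [cite: GilesSelinger2013, §3.2 Def. 3] -/
def hadamardScaled (F : Type*) [CommRing F] : Matrix (QReg 1) (QReg 1) F :=
  Matrix.of fun x y => if x 0 = true ∧ y 0 = true then (-1 : F) else 1

/-- The phase matrix `diag(1, a)` over `F` (`a = r²` for `S`, `a = r` for `T`).
[Nielsen–Chuang 2010, §4.2 (`S = diag(1, i)`, `T = diag(1, e^{iπ/4})`)] [folklore] -/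
def phaseOver (a : F) : Matrix (QReg 1) (QReg 1) F :=
  Matrix.of fun x y => if x = y then (if x 0 = true then a else 1) else 0

/-- The controlled-NOT matrix over `F` (control wire `0`, target wire `1`), the `0/1` pattern of
`Cryptography.cnot`. [Nielsen–Chuang 2010, §1.3.2] [folklore] -/
def cnotOver (F : Type*) [CommRing F] : Matrix (QReg 2) (QReg 2) F :=
  Matrix.of fun x y => if x 0 = y 0 ∧ x 1 = (y 1 ^^ y 0) then (1 : F) else 0

/-! ### The dictionary: Clifford+`T` syntax evaluated over `F` -/

/-- The matrix over `F` of a placed Clifford+`T` gate, with `r` in the role of `ω = e^{iπ/4}`: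
`H ↦ √2·H = [[1,1],[1,−1]]`, `S ↦ diag(1, r²)`, `T ↦ diag(1, r)`, `CNOT ↦ CNOT` (each placed on
its wires), oracle queries `↦ 1`. For `F = ℂ`, `r = ω` this is `√2^{[q = H]}` times the gate's
matrix. [Giles–Selinger 2013, §3 Def. 1 and §3.2 Def. 3 (Clifford+`T` matrices scaled by
`√2^k` have entries in `ℤ[ω]`)] [cite: GilesSelinger2013, §3 Def. 1] -/
def modGateMat (r : F) : QGate cliffordT n → Matrix (QReg n) (QReg n) F
  | .gate .H e => placeGate e (hadamardScaled F)
  | .gate .S e => placeGate e (phaseOver (r ^ 2))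
  | .gate .T e => placeGate e (phaseOver r)
  | .gate .CNOT e => placeGate e (cnotOver F)
  | .oracle _ _ => 1

/-- The matrix over `F` of a Clifford+`T` circuit under the dictionary `modGateMat r`: the
product of the gate matrices with the FIRST gate RIGHTMOST (the convention of
`QCircuit.toMatrix`). [Giles–Selinger 2013, §3.2 Def. 3] [cite: GilesSelinger2013, §3.2 Def. 3] -/
def modGateEval (r : F) (C : QCircuit cliffordT n) : Matrix (QReg n) (QReg n) F :=
  (C.gates.map (modGateMat r)).reverse.prod

/-- The **magic vector** over `F`: `x ↦ r^{|x|}` (`|x|` = Hamming weight). For `F = ℂ`, `r = ω`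
this is `√2ⁿ · |T⟩^{⊗n}`, `|T⟩ = (|0⟩ + ω|1⟩)/√2`. [Bravyi–Gosset 2016, §I (the magic state
`|A⟩ = 2^{-1/2}(|0⟩ + e^{iπ/4}|1⟩)` and `A^{⊗t}`)] [cite: BravyiGosset2016, §I] -/
def magicVectorOver (r : F) (n : ℕ) : QReg n → F :=
  fun x => r ^ (Finset.univ.filter fun i => x i = true).card

/-- The **stabilizer vectors over `F`**: the vectors `M e₀` where `M = modGateEval r C` for a
`T`-free, oracle-free Clifford+`T` circuit `C` on `n` wires and `e₀ = Pi.single 0ⁿ 1`. Over `ℂ`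
with `r = ω` these are the multiples `√2^{#H(C)} · C|0ⁿ⟩` of the stabilizer states
(Aaronson–Gottesman 2004, Thm. 1: stabilizer states = Clifford circuits applied to `|0ⁿ⟩`;
Peleg–Shpilka–Volk 2022, §2.1: unnormalised stabilizer functions).
[cite: AaronsonGottesman2004, Thm. 1] -/
def stabilizerVectorsOver (r : F) (n : ℕ) : Set (QReg n → F) :=
  {v | ∃ C : QCircuit cliffordT n, C.IsOracleFree ∧ C.tCount = 0 ∧
    v = modGateEval r C *ᵥ Pi.single (fun _ => false) 1}

/-- **`k`-term representability over `F`**: `v = ∑_{i<k} cᵢ φᵢ` with coefficients `cᵢ ∈ F` and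
stabilizer vectors `φᵢ ∈ stabilizerVectorsOver r n`. [Peleg–Shpilka–Volk 2022, §2.1 (stabilizer
rank of a function), with coefficients in `F`] [cite: PelegShpilkaVolk2022, §2.1] -/
def RepresentableOver (r : F) (k : ℕ) (v : QReg n → F) : Prop :=
  ∃ (c : Fin k → F) (φ : Fin k → QReg n → F),
    (∀ i, φ i ∈ stabilizerVectorsOver r n) ∧ v = ∑ i, c i • φ i

/-- The **stabilizer rank over `F`**, `χ_F(v)`: the least `k` such that `v` is an `F`-linear
combination of `k` stabilizer vectors over `F` (`sInf`, junk value `0` on an empty set).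
[Peleg–Shpilka–Volk 2022, §2.1; Bravyi–Gosset 2016, §I (`χ`)] [cite: PelegShpilkaVolk2022, §2.1] -/
def stabilizerRankOver (r : F) (v : QReg n → F) : ℕ :=
  sInf {k | RepresentableOver r k v}

/-! ### Unfolding the evaluation -/

/-- The empty circuit evaluates to `1`. [folklore] -/
@[simp] theorem modGateEval_nil (r : F) : modGateEval r (⟨[]⟩ : QCircuit cliffordT n) = 1 := by
  simp [modGateEval]

/-- Prepending a gate: it acts first, i.e. it is the rightmost factor. [folklore] -/
@[simp] theorem modGateEval_cons (r : F) (q : QGate cliffordT n) (qs : List (QGate cliffordT n)) :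
    modGateEval r ⟨q :: qs⟩ = modGateEval r ⟨qs⟩ * modGateMat r q := by
  simp [modGateEval]

/-- Concatenation of circuits evaluates to the product (second circuit on the left). [folklore] -/
theorem modGateEval_append (r : F) (C D : QCircuit cliffordT n) :
    modGateEval r (C.append D) = modGateEval r D * modGateEval r C := by
  simp [modGateEval, QCircuit.append, List.map_append, List.reverse_append, List.prod_append]

/-- The magic vector at a basis label (definitional). [folklore] -/
theorem magicVectorOver_apply (r : F) (x : QReg n) :
    magicVectorOver r n x = r ^ (Finset.univ.filter fun i => x i = true).card := rfl

/-- The magic vector takes the value `1` at `0ⁿ`. [folklore] -/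
@[simp] theorem magicVectorOver_apply_zero (r : F) (n : ℕ) :
    magicVectorOver r n (fun _ => false) = 1 := by
  simp [magicVectorOver]

/-! ### Stabilizer vectors -/

/-- A `T`-free oracle-free circuit applied to `e₀` gives a stabilizer vector (definitional).
[Aaronson–Gottesman 2004, Thm. 1] [folklore] -/
theorem mulVec_single_mem_stabilizerVectorsOver (r : F) {C : QCircuit cliffordT n}
    (hC : C.IsOracleFree) (hT : C.tCount = 0) :
    modGateEval r C *ᵥ Pi.single (fun _ => false) 1 ∈ stabilizerVectorsOver r n :=
  ⟨C, hC, hT, rfl⟩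

/-- `e₀ = |0ⁿ⟩` is a stabilizer vector (empty circuit). [folklore] -/
theorem single_mem_stabilizerVectorsOver (r : F) (n : ℕ) :
    (Pi.single (fun _ => false) 1 : QReg n → F) ∈ stabilizerVectorsOver r n :=
  ⟨⟨[]⟩, fun _ h => by simp at h, rfl, by rw [modGateEval_nil, Matrix.one_mulVec]⟩

/-- Stabilizer vectors are closed under `T`-free oracle-free circuits. [Aaronson–Gottesman 2004,
§I] [folklore] -/
theorem mulVec_mem_stabilizerVectorsOver (r : F) {C : QCircuit cliffordT n} (hC : C.IsOracleFree)
    (hT : C.tCount = 0) {v : QReg n → F} (hv : v ∈ stabilizerVectorsOver r n) :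
    modGateEval r C *ᵥ v ∈ stabilizerVectorsOver r n := by
  obtain ⟨D, hD, hDT, rfl⟩ := hv
  refine ⟨D.append C, fun g hg => ?_, by simp [hDT, hT], ?_⟩
  · rw [QCircuit.gates_append, List.mem_append] at hg
    exact hg.elim (hD g) (hC g)
  · rw [modGateEval_append, Matrix.mulVec_mulVec]

/-! ### Representability and rank -/

/-- A stabilizer vector is `1`-representable. [folklore] -/
theorem RepresentableOver.of_mem {r : F} {v : QReg n → F} (hv : v ∈ stabilizerVectorsOver r n) :
    RepresentableOver r 1 v :=
  ⟨fun _ => 1, fun _ => v, fun _ => hv, by simp⟩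

/-- `0`-representable means zero. [folklore] -/
theorem representableOver_zero_iff (r : F) (v : QReg n → F) : RepresentableOver r 0 v ↔ v = 0 := by
  constructor
  · rintro ⟨c, φ, -, rfl⟩
    simp
  · rintro rfl
    exact ⟨Fin.elim0, Fin.elim0, fun i => i.elim0, by simp⟩

/-- Scalar multiples of representable vectors are representable with the same number of terms.
[folklore] -/
theorem RepresentableOver.smul {r : F} {k : ℕ} {v : QReg n → F} (h : RepresentableOver r k v)
    (a : F) : RepresentableOver r k (a • v) := by
  obtain ⟨c, φ, hφ, rfl⟩ := h
  exact ⟨fun i => a * c i, φ, hφ, by simp [Finset.smul_sum, smul_smul]⟩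

/-- Sums: `k`- and `k'`-representable vectors add to a `(k + k')`-representable one. [folklore] -/
theorem RepresentableOver.add {r : F} {k k' : ℕ} {v w : QReg n → F} (hv : RepresentableOver r k v)
    (hw : RepresentableOver r k' w) : RepresentableOver r (k + k') (v + w) := by
  obtain ⟨c, φ, hφ, rfl⟩ := hv
  obtain ⟨c', φ', hφ', rfl⟩ := hw
  refine ⟨Fin.append c c', Fin.append φ φ', fun i => ?_, ?_⟩
  · refine Fin.addCases (fun i => ?_) (fun i => ?_) i
    · simpa using hφ i
    · simpa using hφ' i
  · rw [Fin.sum_univ_add]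
    simp

/-- **Monotonicity, one step**: pad with the term `0 • e₀`. [folklore] -/
theorem RepresentableOver.succ {r : F} {k : ℕ} {v : QReg n → F} (h : RepresentableOver r k v) :
    RepresentableOver r (k + 1) v := by
  have h0 : RepresentableOver r 1 (0 : QReg n → F) := by
    simpa using (RepresentableOver.of_mem (single_mem_stabilizerVectorsOver r n)).smul 0
  simpa using h.add h0

/-- **Monotonicity of representability in the number of terms.** [folklore] -/
theorem RepresentableOver.mono {r : F} {k k' : ℕ} (hkk' : k ≤ k') {v : QReg n → F}
    (h : RepresentableOver r k v) : RepresentableOver r k' v := by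
  obtain ⟨d, rfl⟩ := Nat.exists_eq_add_of_le hkk'
  induction d with
  | zero => simpa using h
  | succ d ih => exact (ih (Nat.le_add_right k d)).succ

/-- A `k`-term representation bounds the rank by `k`. [folklore] -/
theorem stabilizerRankOver_le {r : F} {k : ℕ} {v : QReg n → F} (h : RepresentableOver r k v) :
    stabilizerRankOver r v ≤ k :=
  Nat.sInf_le h

/-- If `v` is representable at all, it is representable with `χ_F(v)` terms. [folklore] -/
theorem representableOver_stabilizerRankOver {r : F} {k : ℕ} {v : QReg n → F}
    (h : RepresentableOver r k v) : RepresentableOver r (stabilizerRankOver r v) v :=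
  Nat.sInf_mem (s := {k | RepresentableOver r k v}) ⟨k, h⟩

/-- **`χ_F(v) ≤ k` iff `v` is `k`-representable** (for representable `v`; by monotonicity the
set of admissible `k` is an upper set). [folklore] -/
theorem stabilizerRankOver_le_iff {r : F} {v : QReg n → F} (h : ∃ k, RepresentableOver r k v)
    {k : ℕ} : stabilizerRankOver r v ≤ k ↔ RepresentableOver r k v := by
  obtain ⟨k₀, hk₀⟩ := h
  exact ⟨fun hle => (representableOver_stabilizerRankOver hk₀).mono hle, stabilizerRankOver_le⟩

/-- Lower bounds: `k < χ_F(v)` iff `v` has no `k`-term representation (for representable `v`).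
[folklore] -/
theorem lt_stabilizerRankOver_iff {r : F} {v : QReg n → F} (h : ∃ k, RepresentableOver r k v)
    {k : ℕ} : k < stabilizerRankOver r v ↔ ¬ RepresentableOver r k v := by
  rw [← not_le, stabilizerRankOver_le_iff h]

/-- The zero vector has rank `0`. [folklore] -/
@[simp] theorem stabilizerRankOver_zero (r : F) (n : ℕ) :
    stabilizerRankOver r (0 : QReg n → F) = 0 :=
  Nat.eq_zero_of_le_zero (stabilizerRankOver_le ((representableOver_zero_iff r _).2 rfl))

/-- A stabilizer vector has rank at most `1`. [folklore] -/
theorem stabilizerRankOver_le_one_of_mem {r : F} {v : QReg n → F}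
    (hv : v ∈ stabilizerVectorsOver r n) : stabilizerRankOver r v ≤ 1 :=
  stabilizerRankOver_le (RepresentableOver.of_mem hv)

/-! ### The list form used by the route items -/

/-- **List form of representability**: `v` is `k`-representable iff there is a list of `k` pairs
(`T`-free oracle-free circuit `Cⱼ`, coefficient `cⱼ`) with `v = Σⱼ cⱼ • (modGateEval r Cⱼ) e₀` —
the shape inlined in `Theses/ModularRank.lean`. [folklore] -/
theorem representableOver_iff_exists_list (r : F) (k : ℕ) (v : QReg n → F) :
    RepresentableOver r k v ↔ ∃ L : List (QCircuit cliffordT n × F),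
      (∀ x ∈ L, x.1.IsOracleFree ∧ x.1.tCount = 0) ∧ L.length = k ∧
      v = (L.map fun x => x.2 • (modGateEval r x.1 *ᵥ Pi.single (fun _ => false) 1)).sum := by
  constructor
  · rintro ⟨c, φ, hφ, rfl⟩
    choose C hC hT hφC using hφ
    refine ⟨List.ofFn fun i => (C i, c i), ?_, by simp, ?_⟩
    · intro x hx
      rw [List.mem_ofFn] at hx
      obtain ⟨i, rfl⟩ := hx
      exact ⟨hC i, hT i⟩
    · rw [List.map_ofFn, List.sum_ofFn]
      exact Finset.sum_congr rfl fun i _ => by simp [hφC i]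
  · rintro ⟨L, hL, rfl, rfl⟩
    refine ⟨fun i => (L.get i).2, fun i => modGateEval r (L.get i).1 *ᵥ Pi.single (fun _ => false) 1,
      fun i => ?_, ?_⟩
    · obtain ⟨h1, h2⟩ := hL _ (List.get_mem L i)
      exact mulVec_single_mem_stabilizerVectorsOver r h1 h2
    · rw [← List.sum_ofFn]
      congr 1
      exact (List.ofFn_getElem_eq_map L _).symm

/-! ### Reduction along ring homomorphisms -/

/-- The scaled Hadamard matrix is preserved by ring homomorphisms. [folklore] -/
theorem hadamardScaled_map (θ : F →+* K) : (hadamardScaled F).map θ = hadamardScaled K := by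
  ext x y
  simp [hadamardScaled, apply_ite θ]

/-- Phase matrices map to phase matrices. [folklore] -/
theorem phaseOver_map (θ : F →+* K) (a : F) : (phaseOver a).map θ = phaseOver (θ a) := by
  ext x y
  simp [phaseOver, apply_ite θ]

/-- The CNOT matrix is preserved by ring homomorphisms. [folklore] -/
theorem cnotOver_map (θ : F →+* K) : (cnotOver F).map θ = cnotOver K := by
  ext x y
  simp [cnotOver, apply_ite θ]

/-- Gate placement commutes with entrywise ring homomorphisms. [folklore] -/
theorem placeGate_map_ringHom {k : ℕ} (θ : F →+* K) (e : Fin k ↪ Fin n)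
    (U : Matrix (QReg k) (QReg k) F) : (placeGate e U).map θ = placeGate e (U.map θ) := by
  ext x y
  simp [placeGate_apply, apply_ite θ]

/-- **Reduction lemma, one gate**: `θ` applied entrywise to the matrix over `F` of a gate is the
matrix over `K` of the same gate with `r ↦ θ r`. [folklore] -/
theorem modGateMat_map (θ : F →+* K) (r : F) (q : QGate cliffordT n) :
    (modGateMat r q).map θ = modGateMat (θ r) q := by
  cases q with
  | gate g e =>
    cases g
    · simp only [modGateMat, placeGate_map_ringHom]
      exact congrArg (placeGate e) (hadamardScaled_map θ)
    · simp only [modGateMat, placeGate_map_ringHom]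
      exact congrArg (placeGate e) ((phaseOver_map θ (r ^ 2)).trans (by rw [map_pow]))
    · simp only [modGateMat, placeGate_map_ringHom]
      exact congrArg (placeGate e) (phaseOver_map θ r)
    · simp only [modGateMat, placeGate_map_ringHom]
      exact congrArg (placeGate e) (cnotOver_map θ)
  | oracle k e => simp [modGateMat]

/-- **Reduction lemma**: for a ring homomorphism `θ : F → K` (e.g. `ℤ[ω] → 𝔽_p`, `ω ↦ r`),
`θ (modGateEval r C) = modGateEval (θ r) C` entrywise. [folklore] -/
theorem modGateEval_map (θ : F →+* K) (r : F) (C : QCircuit cliffordT n) :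
    (modGateEval r C).map θ = modGateEval (θ r) C := by
  obtain ⟨gs⟩ := C
  induction gs with
  | nil => simp
  | cons q qs ih =>
    rw [modGateEval_cons, modGateEval_cons, Matrix.map_mul, modGateMat_map]
    exact congrArg (· * _) ih

/-- The magic vector reduces to the magic vector: `θ ∘ (x ↦ r^{|x|}) = (x ↦ (θ r)^{|x|})`.
[folklore] -/
theorem magicVectorOver_map (θ : F →+* K) (r : F) (n : ℕ) :
    θ ∘ magicVectorOver r n = magicVectorOver (θ r) n := by
  funext x
  simp [magicVectorOver]

/-- `θ ∘ e₀ = e₀`. [folklore] -/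
theorem ringHom_comp_single (θ : F →+* K) (y : QReg n) :
    θ ∘ (Pi.single y 1 : QReg n → F) = Pi.single y 1 := by
  funext x
  by_cases h : x = y
  · subst h; simp
  · simp [h]

/-- Stabilizer vectors reduce to stabilizer vectors. [folklore] -/
theorem stabilizerVectorsOver_map (θ : F →+* K) {r : F} {v : QReg n → F}
    (hv : v ∈ stabilizerVectorsOver r n) : θ ∘ v ∈ stabilizerVectorsOver (θ r) n := by
  obtain ⟨C, hC, hT, rfl⟩ := hv
  refine ⟨C, hC, hT, ?_⟩
  funext x
  rw [← modGateEval_map, ← ringHom_comp_single θ]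
  exact RingHom.map_mulVec θ _ _ x

/-- **Representability transfers along ring homomorphisms** (with the same number of terms).
[folklore] -/
theorem RepresentableOver.map (θ : F →+* K) {r : F} {k : ℕ} {v : QReg n → F}
    (h : RepresentableOver r k v) : RepresentableOver (θ r) k (θ ∘ v) := by
  obtain ⟨c, φ, hφ, rfl⟩ := h
  refine ⟨fun i => θ (c i), fun i => θ ∘ φ i, fun i => stabilizerVectorsOver_map θ (hφ i), ?_⟩
  funext x
  simp [Finset.sum_apply, Pi.smul_apply]

/-- **The rank can only drop under reduction**: `χ_K(θ ∘ v) ≤ χ_F(v)` (for representable `v`).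
[folklore] -/
theorem stabilizerRankOver_map_le (θ : F →+* K) {r : F} {v : QReg n → F}
    (h : ∃ k, RepresentableOver r k v) :
    stabilizerRankOver (θ r) (θ ∘ v) ≤ stabilizerRankOver r v := by
  obtain ⟨k, hk⟩ := h
  exact stabilizerRankOver_le ((representableOver_stabilizerRankOver hk).map θ)

/-! ### Bridge to the inline evaluation of `Theses/ModularRank.lean` -/

/-- On `T`-free circuits `modGateEval r` agrees with the evaluation term inlined in the items of
route `QuantumAdvantage/ModularRank` (which sends `T ↦ 1` and spells the gate matrices out as
`Matrix.of` terms). [folklore] -/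
theorem modGateEval_eq_inline (r : F) {C : QCircuit cliffordT n} (hT : C.tCount = 0) :
    modGateEval r C = (C.gates.map fun q => match q with
      | .gate .H e => placeGate e (Matrix.of fun x y : QReg 1 =>
          if x 0 = true ∧ y 0 = true then (-1 : F) else 1)
      | .gate .S e => placeGate e (Matrix.of fun x y : QReg 1 =>
          if x = y then (if x 0 = true then r ^ 2 else (1 : F)) else 0)
      | .gate .T _ => 1
      | .gate .CNOT e => placeGate e (Matrix.of fun x y : QReg 2 =>
          if x 0 = y 0 ∧ x 1 = (y 1 ^^ y 0) then (1 : F) else 0)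
      | .oracle _ _ => 1).reverse.prod := by
  unfold modGateEval
  congr 2
  refine List.map_congr_left fun q hq => ?_
  rw [QCircuit.tCount_eq_zero_iff] at hT
  cases q with
  | gate g e =>
    cases g
    · rfl
    · rfl
    · exact absurd rfl (hT _ hq e)
    · rfl
  | oracle k e => rfl

end Literature.Computability.QuantumComplexity
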